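import Summits.BirchSwinnertonDyer.Rank1Residual.X11b.VisibilityRankOne
import Summits.BirchSwinnertonDyer.Rank1Residual.X11b.ChaPairsMinimality
import Summits.BirchSwinnertonDyer.BirchSwinnertonDyer.Theorems.Rank1ResidualIntModelSurjectivity
import Summits.BirchSwinnertonDyer.BirchSwinnertonDyer.Theorems.Rank1ResidualX11RankOneMinimality
import Summits.BirchSwinnertonDyer.BirchSwinnertonDyer.Theorems.Rank1ResidualX11RankOneReduction
import Literature.NumberTheory.EllipticCurves.PointCountEulerCriterion
import Literature.NumberTheory.EllipticCurves.CongruentNumberCurveSupersingular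
import Literature.NumberTheory.EllipticCurves.SelmerCorankControlRatProofs
import HarnessLib

/-!
# BSD rank-≤1 residual cell, class X11b: `BSD(E,5)` for `403280bd1` (`#Ш_an = 25`, rank one) from
# PUBLISHED theorems + a two-engine certificate (Kolyvagin upper half, VISIBILITY lower half)

HONEST FRAMING (cell `b2b-bsdres-*`, verbatim): prove what is provable now; shrink each hard class
to its core with data; no claim beyond stated classes; COMBINATION classes deleted from PUBLISHED
theorems only, CONSTRUCTION-shaped remainder typed; this is not "finishing BSD". Class X11b stays
CONSTRUCTION-SHAPED; everything here is PER PAIR; no lane verdict is changed; no named fact.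

Unit `b2b-bsdres-x11c`, gen 4. The ONLY pair of the unit's census (X11 ∧ `r = 1` ∧ ¬sst ∧ `p ≥ 5`,
Cremona `N < 5·10⁵`) with `p ∣ #Ш_an` is `403280bd1@5` (HOME/b2b-bsdres-x11c/RESISTANT.md §B):
`E = [0,-1,0,1908859,-1069809235]`, `N = 403280 = 2⁴·5·71²`, `Δ = -2¹²·5·71⁹`, Kodaira `II*`, `I₁`
(non-split), `III*` at `2, 5, 71`, `∏ c_q = 2`, `E(ℚ)_tors = 0`, `ρ̄_{E,5}` ONTO (no (ram) prime:
`5` is the only multiplicative prime), `r_an = 1`, `#Ш_an = 25`. Kato's divisibility under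
surjectivity gives only the upper half; the (ram)-free main-conjecture lower bound is not in print.
The per-pair route of `X11b/VisibilityRankOne.lean` closes it from PUBLISHED theorems plus finite
certificates:

* UPPER half (Kolyvagin via McCallum 1991 §1 / Gross 1991 Thm. 1.3 (2), tree named facts `kolyvagin`,
  `Kolyvagin1990_padicValNat_card_sha_le`): Heegner field `K = ℚ(√-31)` (all of `2, 5, 71` split;
  `5 ∤ 31`), Heegner point `y_K` of infinite order with `m = √(4ρ) = 40`, `ord₅ m = 1` — two engines
  of gen 3 AGREE (engine 1 cypari2 job j077800: `L'(E,1) = 13.5753325477663689…`,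
  `L(E^D,1) = 0.30206536693…`, `ĥ(x) = 3.2258748694…`, `ρ = 400`; engine 2 stdlib job j077970: `m = 40`,
  `ord₅ m = 1`, `E(K)[5] = 0`); hence `ord₅ [E(K) : ℤ y_K] = ord₅ m = 1` and `ord₅ #Ш(E/ℚ) ≤ 2`.
* LOWER half (KERNEL visibility count `exists_sha_ne_zero_of_congr` — Cremona–Mazur 2000 §3 /
  Agashe–Stein 2002 Thm. 3.1 made unconditional at `p ∣ N` in the tree — plus Cassels–Tate, bsd.S18):
  the partner `E' = 403280a1 = [0,0,0,-37843,2833042]` (same conductor; Cremona RANK 3, generators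
  `(121,160)`, `(71,710)`, `(111,10)`; `E'(ℚ)_tors = 0`; Kodaira `I₉*`, `I₂` non-split, `III` at
  `2, 5, 71`, `c_q = 4, 2, 2`) is `5`-CONGRUENT to `E`: `a_ℓ(E) ≡ a_ℓ(E') (mod 5)` for ALL primes
  `ℓ ≤ 122688 = μ(403280)/6` (`μ = [SL₂(ℤ):Γ₀(N)] = 736128`; `a_2 = a_71 = 0`, `a_5 = -1` for both) —
  engine A (pure python point counting, job j079010: 11537 primes, max `122663`, none non-congruent)
  = engine B (PARI `ellan`, jobs j079008/j080000: all `a_n`, `n ≤ 122688`, congruent; 11537 primes,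
  max `122663`), so `E[5] ≅ E'[5]` as `Γ_ℚ`-modules by Kraus–Oesterlé 1992 Prop. 4 (same conductor,
  no mismatched multiplicative prime: `M = N`, bound `μ(M)/6`; `E[5]` irreducible since `ρ̄_{E,5}` is
  onto) — equivalently Sturm's bound + Cremona–Mazur 2000 p. 21 (1)⇔(3); `[E'(ℚ):5E'(ℚ)] ≥ 125`
  (engine A: three reduction functionals at `ℓ = 43, 53, 59` with invertible `3×3` matrix mod `5`;
  engine B: the same functionals, and PARI `ellrank = [3,3]`, height-pairing determinant
  `0.9530621209…` = Cremona's regulator); `E'(ℚ_v)[5] = 0` for `v ∈ S = {2, 5, 71}` (engine A: Tate's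
  algorithm — additive `I₉*`/`III` at `2`/`71` with `c_v ∈ {4,2}`, non-split `I₂` at `5`, `e = 1 < 4`;
  engine B: PARI `polrootspadic(ψ₅)` + `y`-test: `2`/`0`/`0` roots, none with `y ∈ ℚ_v`). Hence
  `[E(ℚ):5E(ℚ)] · ∏_{v∈S} #E'(ℚ_v)[5] · 5 = 5·1·5 = 25 < 125 ≤ [E'(ℚ):5E'(ℚ)]`: `Ш(E)[5] ≠ 0`, so
  `25 ∣ #Ш(E/ℚ)` (Cassels–Tate) and `ord₅ #Ш(E/ℚ) = 2 = ord₅ #Ш_an`.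

KERNEL facts for the literal models (this file, `decide`): `Δ(E) ≠ 0`, `Δ(E') ≠ 0`, global minimality
of `E` (Kraus pattern `c₆ = 2⁹L`, `L ≡ 3 (mod 4)`, `ord₂ Δ = 12 < 24`:
`isGloballyMinimal_of_krausCriterion_bounded`), `ρ̄_{E,5}` ONTO (Serre 1972 Prop. 19 witnesses
`ℓ = 23` (`a = 4`), `ℓ = 3` (`a = 2`), `ℓ = 3`: kernel point counts `#Ẽ(𝔽₂₃) = 20`, `#Ẽ(𝔽₃) = 2`),
good reduction of `E` and `E'` at every place outside `S = {2, 5, 71}` (`q ∣ Δ ⇒ q ∈ {2,5,71}`) and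
`5 ∉ v` there. BINDERS (per-pair numbers, two engines each, or published named facts): `hCT`, `hGZK`,
`hKo`, `hB`; the Heegner datum (`K`, `N`, `P`, `ord₅ [E(K):ℤP] ≤ 1`); `r_an = 1`; `#Ш_an = s`,
`ord₅ s = 2`; `θ : E'[5] ≃ E[5]` `Γ_ℚ`-equivariant; `rank E'(ℚ) ≥ 3`; `E'(ℚ_v)[5] = 0` at the three
places. Evidence: HOME/b2b-bsdres-x11c/gen4/ (`certA_local.json`, `certB_j080000.txt`, `sturm_j079010.json`),
REPORT.md §13. Lane books the verdict; no label changes.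

References: Cremona–Mazur 2000 §3 [CremonaMazur2000]; Agashe–Stein 2002 Thm. 3.1 [AgasheStein2002];
Kraus–Oesterlé 1992 Prop. 4 [KrausOesterle1992]; McCallum 1991 §1 [McCallumLMS1991]; Gross 1991
Thm. 1.3 [GrossLMS1991]; Serre 1972 §2.8 Prop. 19 [Serre1972]; Kraus 1989 Prop. 2 [Kraus1989];
Silverman AEC VII.1, X.4.14 [SilvermanAEC2009]; Miller 2011 Def. 1.1, Thm. 4.1, Cor. 4.8
[Miller2011LMS]; Cremona's tables [Cremona2006].
-/

set_option autoImplicit false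

noncomputable section

open scoped Classical

open WeierstrassCurve Literature.NumberTheory.EllipticCurves
  Literature.NumberTheory.EllipticCurves.Rank1Residual
  Literature.NumberTheory.EllipticCurves.Rank1Residual.X11RankOneCertificates
  Summit.BirchSwinnertonDyer.BirchSwinnertonDyer.Rank1Residual.IntModel
  Summit.BirchSwinnertonDyer.BirchSwinnertonDyer.Rank1Residual.X11RankOne
open NumberField IsDedekindDomain

namespace Summit.BirchSwinnertonDyer.Rank1Residual.X11b

/-! ### §1. Kernel point counts for the Serre witnesses of `403280bd1` at `p = 5` -/

/-- `#Ẽ(𝔽₃) = 2` (`a_3 = 2`) for Cremona's model `403280bd1`. [folklore] -/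
theorem card_v403280bd1_3 :
    Nat.card (((⟨0, -1, 0, 1908859, -1069809235⟩ : WeierstrassCurve ℤ).map
      (Int.castRingHom (ZMod 3))).toAffine.Point) = 2 := by
  rw [@WeierstrassCurve.natCard_point_eq_one_add_card (ZMod 3) (@ZMod.instField 3 ⟨by norm_num⟩) _ _ _
    (by decide +kernel), @card_sol_eq_sum_euler (ZMod 3) (@ZMod.instField 3 ⟨by norm_num⟩) _ _
    (by rw [ZMod.ringChar_zmod_n]; decide), ZMod.card]
  decide +kernel

/-- `#Ẽ(𝔽₂₃) = 20` (`a_23 = 4`) for Cremona's model `403280bd1`. [folklore] -/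
theorem card_v403280bd1_23 :
    Nat.card (((⟨0, -1, 0, 1908859, -1069809235⟩ : WeierstrassCurve ℤ).map
      (Int.castRingHom (ZMod 23))).toAffine.Point) = 20 := by
  rw [@WeierstrassCurve.natCard_point_eq_one_add_card (ZMod 23) (@ZMod.instField 23 ⟨by norm_num⟩) _ _ _
    (by decide +kernel), @card_sol_eq_sum_euler (ZMod 23) (@ZMod.instField 23 ⟨by norm_num⟩) _ _
    (by rw [ZMod.ringChar_zmod_n]; decide), ZMod.card]
  decide +kernel

/-! ### §2. `ρ̄_{E,5}` is onto, in the kernel (Serre 1972 Prop. 19) -/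

/-- **`ρ̄_{E,5}` is onto for `403280bd1`** (Serre witnesses mod `5`: `ℓ = 23`, `a_23 = 4`
(`a² - 4ℓ = -76 ≡ 4`, a non-zero square: split Cartan excluded); `ℓ = 3`, `a_3 = 2` (`a² - 4ℓ = -8 ≡ 2`,
a non-square: non-split Cartan excluded); `ℓ = 3` (`u = a²/ℓ = 4·2 ≡ 3 ∉ {0,1,2,4}`, `u²-3u+1 ≡ 1 ≠ 0`:
exceptional images excluded); Prop. 19 ⇒ `G ⊇ SL₂(𝔽₅)`, `det = χ₅` onto), for any globally minimal
elliptic `W/ℚ` with this integral model. The two engines find the same witnesses (engine A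
`certA.py` C5, engine B PARI j080000 C5); the kernel re-verifies the point counts.
[cite: Serre1972, §2.8 Prop. 19] -/
theorem surj_v403280bd1 {W : WeierstrassCurve ℚ} [W.IsElliptic] [W.IsGloballyMinimal]
    (hI : integralModelInt W = ⟨0, -1, 0, 1908859, -1069809235⟩) : W.HasSurjectiveModNGaloisRep 5 :=
  @hasSurjectiveModNGaloisRep_of_intModel_of_serreWitnesses W _ _ _ hI 5 ⟨by norm_num⟩ (by norm_num)
    23 3 3 ⟨by norm_num⟩ ⟨by norm_num⟩ ⟨by norm_num⟩ (by decide) (by decide) (by decide)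
    (by decide +kernel) (by decide +kernel) (by decide +kernel) _ _ _
    card_v403280bd1_23 card_v403280bd1_3 card_v403280bd1_3
    (by decide +kernel) (by decide +kernel) (by decide +kernel)

/-! ### §3. Good reduction of both models outside `{2, 5, 71}` -/

/-- A prime dividing `2^a · 5^b · 71^c` is `2`, `5` or `71`. [folklore] -/
theorem eq_of_prime_dvd_two_five_seventyone {q a b c : ℕ} (hq : q.Prime)
    (h : q ∣ 2 ^ a * 5 ^ b * 71 ^ c) : q = 2 ∨ q = 5 ∨ q = 71 := by
  rcases (Nat.Prime.dvd_mul hq).mp h with h25 | h71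
  · rcases (Nat.Prime.dvd_mul hq).mp h25 with h2 | h5
    · exact Or.inl ((Nat.prime_dvd_prime_iff_eq hq Nat.prime_two).mp (hq.dvd_of_dvd_pow h2))
    · exact Or.inr (Or.inl ((Nat.prime_dvd_prime_iff_eq hq (by norm_num)).mp (hq.dvd_of_dvd_pow h5)))
  · exact Or.inr (Or.inr ((Nat.prime_dvd_prime_iff_eq hq (by norm_num)).mp (hq.dvd_of_dvd_pow h71)))

/-- **Outside the places of `2`, `5`, `71` both `403280bd1` and `403280a1` have good reduction and the
place does not contain `5`** (`|Δ(E)| = 2¹²·5·71⁹`, `Δ(E') = 2¹⁷·5²·71³`; an integral equation with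
`v`-unit discriminant has good reduction, Silverman AEC VII.1 Rem. 1.1 / VII.5 Prop. 5.1(a); tree
`hasGoodReductionAt_map_of_not_dvd`). The set `S` of the visibility count. [cite: SilvermanAEC2009, VII.5 Prop. 5.1(a)] -/
theorem good_outside_v403280 (v : HeightOneSpectrum (𝓞 ℚ))
    (hv : v ∉ ({(Rat.HeightOneSpectrum.primesEquiv (R := 𝓞 ℚ)).symm ⟨2, Nat.prime_two⟩,
      (Rat.HeightOneSpectrum.primesEquiv (R := 𝓞 ℚ)).symm ⟨5, by norm_num⟩,
      (Rat.HeightOneSpectrum.primesEquiv (R := 𝓞 ℚ)).symm ⟨71, by norm_num⟩} :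
        Finset (HeightOneSpectrum (𝓞 ℚ)))) :
    (⟨0, -1, 0, 1908859, -1069809235⟩ : WeierstrassCurve ℚ).HasGoodReductionAt v ∧
      (⟨0, 0, 0, -37843, 2833042⟩ : WeierstrassCurve ℚ).HasGoodReductionAt v ∧
      (5 : 𝓞 ℚ) ∉ v.asIdeal := by
  set e := Rat.HeightOneSpectrum.primesEquiv (R := 𝓞 ℚ) with he
  have hq : (e v : ℕ).Prime := (e v).2
  -- the prime of `v` is none of `2, 5, 71`
  have hne : ¬ ((e v : ℕ) = 2 ∨ (e v : ℕ) = 5 ∨ (e v : ℕ) = 71) := by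
    intro h
    apply hv
    simp only [Finset.mem_insert, Finset.mem_singleton]
    rcases h with h | h | h
    · left; apply e.injective; rw [Equiv.apply_symm_apply]; exact Subtype.ext h
    · right; left; apply e.injective; rw [Equiv.apply_symm_apply]; exact Subtype.ext h
    · right; right; apply e.injective; rw [Equiv.apply_symm_apply]; exact Subtype.ext h
  have hΔE : ¬ ((e v : ℕ) : ℤ) ∣ (⟨0, -1, 0, 1908859, -1069809235⟩ : WeierstrassCurve ℤ).Δ := by
    intro h
    rw [intCurve_Δ, Int.natCast_dvd] at h
    have habs : (discOf [0, -1, 0, 1908859, -1069809235]).natAbs = 2 ^ 12 * 5 ^ 1 * 71 ^ 9 := by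
      decide +kernel
    exact hne (eq_of_prime_dvd_two_five_seventyone hq (habs ▸ h))
  have hΔF : ¬ ((e v : ℕ) : ℤ) ∣ (⟨0, 0, 0, -37843, 2833042⟩ : WeierstrassCurve ℤ).Δ := by
    intro h
    rw [intCurve_Δ, Int.natCast_dvd] at h
    have habs : (discOf [0, 0, 0, -37843, 2833042]).natAbs = 2 ^ 17 * 5 ^ 2 * 71 ^ 3 := by
      decide +kernel
    exact hne (eq_of_prime_dvd_two_five_seventyone hq (habs ▸ h))
  refine ⟨?_, ?_, fun h5 ↦ hne (Or.inr (Or.inl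
    (Rat.HeightOneSpectrum.primesEquiv_eq_of_natCast_mem v (by norm_num) h5)))⟩
  · have h := hasGoodReductionAt_map_of_not_dvd _ v hΔE
    exact (map_mk_int 0 (-1) 0 1908859 (-1069809235)) ▸ h
  · have h := hasGoodReductionAt_map_of_not_dvd _ v hΔF
    exact (map_mk_int 0 0 0 (-37843) 2833042) ▸ h

/-! ### §4. `BSD(E,5)` for `403280bd1` -/

/-- **`BSD(E,5)` for `403280bd1`** (`N = 403280 = 2⁴·5·71²`; `ρ̄_{E,5}` onto, non-split multiplicative at
`5`, additive at `2` (`II*`), `71` (`III*`), `∏ c_q = 2`, `r_an = 1`, `#Ш_an = 25`) from PUBLISHED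
theorems — Kolyvagin's index bound (`hKo`, `hB`: McCallum 1991 §1 / Gross 1991 Thm. 1.3),
Cassels–Tate (`hCT`), Gross–Zagier–Kolyvagin (`hGZK`) — plus TWO per-pair certificates: the Heegner
datum `K = ℚ(√-31)`, `ord₅ [E(K) : ℤ y_K] ≤ 1` (`m = 40`; gen-3 engines j077800 = j077970) for the
UPPER half, and the `5`-congruent RANK-3 partner `W' = 403280a1` (`θ : E'[5] ≃ E[5]`, from the
two-engine Sturm/Kraus–Oesterlé congruence j079010 = j079008/j080000 and irreducibility of `E[5]`;
`rank E'(ℚ) ≥ 3`: PARI `ellrank = [3,3]` and three independent reduction functionals mod `5`;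
`E'(ℚ_v)[5] = 0` at `v = 2, 5, 71`: Tate's algorithm / `ψ₅` roots) for the LOWER half. Kernel: `Δ ≠ 0`
for both models, global minimality of `W` (`isGloballyMinimal_of_krausCriterion_bounded`, pattern
`c₆ = 2⁹L`, `L ≡ 3 (4)`), `ρ̄_{E,5}` onto (`surj_v403280bd1`), `S = {2,5,71}` with good reduction
outside (`good_outside_v403280`). Per pair; lane books the verdict; no label change.
[cite: McCallumLMS1991, §1 Theorem (Kolyvagin), p. 296] [cite: SilvermanAEC2009, Thm. X.4.14]
[cite: CremonaMazur2000, §3 and Table 1] [cite: KrausOesterle1992, Prop. 4]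
[cite: Miller2011LMS, Def. 1.1, Thm. 4.1, Cor. 4.8] [cite: Cremona2006, Table 1 (labels 403280bd1, 403280a1)] -/
theorem bsdp_v403280bd1 (hCT : exists_casselsTate_pairing (K := ℚ))
    (hGZK : rank_eq_analyticRank_of_analyticRank_le_one)
    (W : WeierstrassCurve ℚ) (hW : W = ⟨0, -1, 0, 1908859, -1069809235⟩)
    {N : ℕ} [NeZero N] {K : Type} [Field K] [NumberField K] (hKo : kolyvagin N W K)
    (hB : Kolyvagin1990_padicValNat_card_sha_le N W K) (hK : IsImaginaryQuadratic K)
    (hH : SatisfiesHeegnerHypothesis N K) {P : (W.baseChange K).toAffine.Point}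
    (hP : IsHeegnerPoint N W K P) (hnt : ¬ IsOfFinAddOrder P)
    (hI : padicValNat 5 (AddSubgroup.zmultiples P).index ≤ 1)
    (hr : W.analyticRank = 1) {s : ℚ} (hs : shaAn W = (s : ℂ)) (hv : padicValRat 5 s = 2)
    (W' : WeierstrassCurve ℚ) (hW' : W' = ⟨0, 0, 0, -37843, 2833042⟩)
    (θ : geomTorsion W' (5 : ℕ) ≃+ geomTorsion W (5 : ℕ))
    (hθ : ∀ (σ : Field.absoluteGaloisGroup ℚ) (Q : geomTorsion W' (5 : ℕ)), θ (σ • Q) = σ • θ Q)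
    (hrank : 3 ≤ W'.mordellWeilRank)
    (hloc : ∀ v ∈ ({(Rat.HeightOneSpectrum.primesEquiv (R := 𝓞 ℚ)).symm ⟨2, Nat.prime_two⟩,
      (Rat.HeightOneSpectrum.primesEquiv (R := 𝓞 ℚ)).symm ⟨5, by norm_num⟩,
      (Rat.HeightOneSpectrum.primesEquiv (R := 𝓞 ℚ)).symm ⟨71, by norm_num⟩} :
        Finset (HeightOneSpectrum (𝓞 ℚ))),
      Nat.card (nsmulAddMonoidHom 5 : (W'.baseChange (v.adicCompletion ℚ)).toAffine.Point →+ _).ker = 1) :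
    BSDp W 5 := by
  subst hW hW'
  -- instances for the literal models, stated in the statement's numeral form (the toolkit lemmas
  -- produce them for the `ℤ`-cast form; the two agree definitionally)
  haveI hE : (⟨0, -1, 0, 1908859, -1069809235⟩ : WeierstrassCurve ℚ).IsElliptic :=
    isElliptic_of_discOf_ne_zero 0 (-1) 0 1908859 (-1069809235) (by decide +kernel)
  haveI hE' : (⟨0, 0, 0, -37843, 2833042⟩ : WeierstrassCurve ℚ).IsElliptic :=
    isElliptic_of_discOf_ne_zero 0 0 0 (-37843) 2833042 (by decide +kernel)
  haveI hM : (⟨0, -1, 0, 1908859, -1069809235⟩ : WeierstrassCurve ℚ).IsGloballyMinimal :=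
    isGloballyMinimal_of_krausCriterion_bounded 0 (-1) 0 1908859 (-1069809235)
      (by decide +kernel) (by decide +kernel) (by decide +kernel)
  haveI : Fact (Nat.Prime 5) := ⟨by norm_num⟩
  have hρ : Surj (⟨0, -1, 0, 1908859, -1069809235⟩ : WeierstrassCurve ℚ) 5 :=
    surj_v403280bd1 (integralModelInt_eq_of_map_eq _ (map_mk_int 0 (-1) 0 1908859 (-1069809235)))
  exact bsdp_of_kolyvagin_of_congr _ 5 hCT hGZK hKo hB hK hH hP hnt (by norm_num) hρ hI hr hs hv _ θ hθ
    hrank _ (fun v hv' ↦ good_outside_v403280 v hv') hloc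

end Summit.BirchSwinnertonDyer.Rank1Residual.X11b

end
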